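import Summits.CriticalPhenomena.PercolationContinuityZ3.Theorems.PercNearOneGluingNoHeavyLowerTailKnQuestion8CoefficientwiseCoreClassKernelMixHubData
import HarnessLib

/-!
# The augmented staircase theorem, closed form (PATH LEMMA of hub-Kleitman, layer 6)

Support file (`--supports stmt-CriticalPhenomena-4575`, closed), prover `prim-cplus-coupling` (gen 51).  No definitions, no notations,
no named facts, no sorries; standard axioms.  Memo `prim-cplus-coupling/A5-COUPLING-gen51.md` §1.6, §2 (Theorem 1), §7(1).

THE CLEAN STATEMENT (`hubStair_matching_closed`).  Natural data of the memo's class 𝒞₀ on the ground set `{0,…,N}`, `N ≥ 2`: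
column tops `om` of a staircase `R = {(x,y) : 1 ≤ x ≤ y ≤ om x}` (`x+1 ≤ om x ≤ N`, nondecreasing), a down-closed cell set
`A ⊆ R` and an up-closed cell set `B ⊆ R` (cells `(x,y)` with `1 ≤ x ≤ y ≤ N-1`).  The even family
`𝔉 = {∅} ∪ {E inner, even, cell(E) ∈ R} ∪ {E ∋ 0 even, cell(E∖0) ∈ A} ∪ {E ∋ N even, cell(E∖N) ∈ B}`
(`cell(X) = (min X, max X)`) admits an injective self-map `σ` with `σ ∅ = ∅` and otherwise `σ E = E ∆ {a} ∆ {b}`, `a < b`,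
`a ≤ e ≤ b` on `E ∪ σ E` — a two-sided hub move.  By memo §1 this is the PATH LEMMA (all four gate types) for one bundle.
Proof: `…HubData.hubStair_data` feeds `…HubFinal.hubStair_matching`; the odd members `{0}`, `{N}` of `𝒱` are invisible.
[cite: KozmaNitzan2024, Questions 8–9 (§5.5 p. 36) (context)]
-/

namespace Summit.CriticalPhenomena.PercolationContinuityZ3.Theorems

open Finset
open scoped symmDiff

namespace Coefficientwise

/-- **Augmented staircase theorem, closed form** (memo gen51 Theorem 1 for the class 𝒞₀ with natural data): the even
family of a staircase with a down-closed `A` and an up-closed `B` has an injective self-map along two-sided hub moves.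
[folklore] -/
theorem hubStair_matching_closed (N : ℕ) (hN : 2 ≤ N) (om : ℕ → ℕ) (A B : Finset (ℕ × ℕ))
    (hom : ∀ x, 1 ≤ x → x ≤ N - 1 → x + 1 ≤ om x ∧ om x ≤ N)
    (hmono : ∀ x y, 1 ≤ x → x ≤ y → y ≤ N - 1 → om x ≤ om y)
    (hAcell : ∀ c ∈ A, 1 ≤ c.1 ∧ c.1 ≤ c.2 ∧ c.2 ≤ N - 1 ∧ c.2 ≤ om c.1)
    (hAdown : ∀ c ∈ A, ∀ x y, 1 ≤ x → x ≤ c.1 → x ≤ y → y ≤ c.2 → (x, y) ∈ A)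
    (hBcell : ∀ c ∈ B, 1 ≤ c.1 ∧ c.1 ≤ c.2 ∧ c.2 ≤ N - 1 ∧ c.2 ≤ om c.1)
    (hBup : ∀ c ∈ B, ∀ x y, c.1 ≤ x → c.2 ≤ y → x ≤ y → y ≤ N - 1 → (x, y) ∈ B)
    (F : Finset ℕ → Prop)
    (hF : ∀ E, F E ↔ Even E.card ∧
      (E = ∅ ∨
       (0 ∉ E ∧ N ∉ E ∧ (∀ e ∈ E, e ≤ N - 1) ∧ ∃ h : E.Nonempty, E.max' h ≤ om (E.min' h)) ∨
       (0 ∈ E ∧ N ∉ E ∧ ∃ h : (E.erase 0).Nonempty, ((E.erase 0).min' h, (E.erase 0).max' h) ∈ A) ∨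
       (N ∈ E ∧ 0 ∉ E ∧ ∃ h : (E.erase N).Nonempty, ((E.erase N).min' h, (E.erase N).max' h) ∈ B))) :
    ∃ σ : Finset ℕ → Finset ℕ,
      (∀ E, F E → F (σ E)) ∧
      (∀ E E', F E → F E' → σ E = σ E' → E = E') ∧
      (∀ E, F E → (E = ∅ ∧ σ E = ∅) ∨
        ∃ a b : ℕ, a < b ∧ σ E = E ∆ {a} ∆ {b} ∧ (∀ e ∈ E, a ≤ e ∧ e ≤ b) ∧ (∀ e ∈ σ E, a ≤ e ∧ e ≤ b)) := by
  classical
  obtain ⟨xi, alpha, alphaP, beta, betaP, sA, dA, bd, db, hxi, hxi2, hRrc, hArow, hAcol, hAR, hAdiag, hAdom, hsd, hsN, hdN,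
    halphaP, hBrow, hBcol, hBR, hBdiag, hBdom, hbd, hbd1, hdbN, hbdN, hbeta1, hbetaP⟩ :=
    hubStair_data N hN om A B hom hmono hAcell hAdown hBcell hBup
  -- the family 𝒱 of `hubStair_matching`
  obtain ⟨V, hV⟩ : ∃ V : Finset ℕ → Prop, ∀ X, V X ↔
      (X = ∅ ∨
      (X.Nonempty ∧ 0 ∉ X ∧ N ∉ X ∧ (∀ e ∈ X, e ≤ N - 1) ∧ ∀ h : X.Nonempty, xi (X.max' h) ≤ X.min' h) ∨
      (0 ∈ X ∧ N ∉ X ∧ (∀ e ∈ X, e ≤ N - 1) ∧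
        ((X = {0} ∧ sA = dA + 1) ∨ ∃ h : (X.erase 0).Nonempty, ((X.erase 0).min' h, (X.erase 0).max' h) ∈ A)) ∨
      (N ∈ X ∧ 0 ∉ X ∧ (∀ e ∈ X, e ≤ N) ∧
        ((X = {N} ∧ bd = db) ∨ ∃ h : (X.erase N).Nonempty, ((X.erase N).min' h, (X.erase N).max' h) ∈ B))) :=
    ⟨_, fun _ => Iff.rfl⟩
  obtain ⟨σ, h1, h2, h3⟩ := hubStair_matching N hN xi om alpha alphaP beta betaP sA dA bd db A B hxi hxi2 hRrc hom hArow
    hAcol hAR hAdiag hAdom hsd hsN hdN halphaP hBrow hBcol hBR hBdiag hBdom hbd hbd1 hdbN hbdN hbeta1 hbetaP V hV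
    _ (fun _ => rfl) _ (fun _ => rfl)
  -- inner sets: `1 ≤ min`, `min ≤ max`
  have hmin1 : ∀ (E : Finset ℕ) (h : E.Nonempty), 0 ∉ E → 1 ≤ E.min' h := by
    intro E h h0
    have hm := E.min'_mem h
    by_contra hc
    have hz : E.min' h = 0 := by omega
    rw [hz] at hm
    exact h0 hm
  -- 𝔉 = even members of 𝒱
  have hFV : ∀ E, F E ↔ V E ∧ Even E.card := by
    intro E
    rw [hF, hV]
    constructor
    · rintro ⟨hev, hcl⟩
      refine ⟨?_, hev⟩
      rcases hcl with h0 | ⟨h0n, hNn, hle, hne, hR⟩ | ⟨h0, hNn, hne, hA⟩ | ⟨hNm, h0n, hne, hB⟩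
      · exact Or.inl h0
      · refine Or.inr (Or.inl ⟨hne, h0n, hNn, hle, fun h => ?_⟩)
        exact (hRrc _ _ (hmin1 E h h0n) (E.min'_le _ (E.max'_mem h)) (hle _ (E.max'_mem h))).mpr hR
      · refine Or.inr (Or.inr (Or.inl ⟨h0, hNn, ?_, Or.inr ⟨hne, hA⟩⟩))
        intro e he
        by_cases he0 : e = 0
        · omega
        · have hc := (hArow _ _).mp hA
          have := (E.erase 0).le_max' e (Finset.mem_erase.mpr ⟨he0, he⟩)
          omega
      · refine Or.inr (Or.inr (Or.inr ⟨hNm, h0n, ?_, Or.inr ⟨hne, hB⟩⟩))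
        intro e he
        by_cases heN : e = N
        · omega
        · have hc := (hBrow _ _).mp hB
          have := (E.erase N).le_max' e (Finset.mem_erase.mpr ⟨heN, he⟩)
          omega
    · rintro ⟨hcl, hev⟩
      refine ⟨hev, ?_⟩
      rcases hcl with h0 | ⟨hne, h0n, hNn, hle, hR⟩ | ⟨h0, hNn, _, hA⟩ | ⟨hNm, h0n, _, hB⟩
      · exact Or.inl h0
      · refine Or.inr (Or.inl ⟨h0n, hNn, hle, hne, ?_⟩)
        exact (hRrc _ _ (hmin1 E hne h0n) (E.min'_le _ (E.max'_mem hne)) (hle _ (E.max'_mem hne))).mp (hR hne)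
      · rcases hA with ⟨hE0, _⟩ | ⟨h, hA⟩
        · exfalso
          rw [hE0, Finset.card_singleton] at hev
          exact Nat.not_even_one hev
        · exact Or.inr (Or.inr (Or.inl ⟨h0, hNn, h, hA⟩))
      · rcases hB with ⟨hEN, _⟩ | ⟨h, hB⟩
        · exfalso
          rw [hEN, Finset.card_singleton] at hev
          exact Nat.not_even_one hev
        · exact Or.inr (Or.inr (Or.inr ⟨hNm, h0n, h, hB⟩))
  refine ⟨σ, ?_, ?_, ?_⟩
  · intro E hE
    obtain ⟨hVE, hev⟩ := (hFV E).mp hE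
    exact (hFV _).mpr (h1 E hVE hev)
  · intro E E' hE hE' h
    obtain ⟨hVE, hev⟩ := (hFV E).mp hE
    obtain ⟨hVE', hev'⟩ := (hFV E').mp hE'
    exact h2 E E' hVE hev hVE' hev' h
  · intro E hE
    obtain ⟨hVE, hev⟩ := (hFV E).mp hE
    exact h3 E hVE hev

end Coefficientwise

end Summit.CriticalPhenomena.PercolationContinuityZ3.Theorems
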